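import Mathlib

/-!
# Solo-informed s18 — orbit bookkeeping for the direct evaluation of the unit pairing (Part II §7.11 (9″))

For a split `σ`-orbit `{𝔔, σ𝔔, …, σ⁴𝔔}` of primes of `L = F′(ε₁^{1/5})` over a prime `𝔮′` of `F′`,
an ideal `(ξ)` of trivial relative norm has exponents `c₀,…,c₄` with `∑ cⱼ = 0`, and
`(ξ) = 𝔄^{1-σ}` with `𝔄 = ∑ⱼ aⱼ σʲ𝔔`, `aⱼ = c₀ + ⋯ + cⱼ`.  The contribution of the orbit to
`[N_{L/F′} 𝔄] ∈ Cl(F′)/5` is `t · [𝔮′]` with `t = ∑ⱼ aⱼ (mod 5)`.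

We record the two identities in `ZMod 5` that make `t` well defined and computable:
* `soloInformed_orbit_moment` : `∑ⱼ aⱼ = -(c₁ + 2c₂ + 3c₃ + 4c₄)` — the value is minus the first
  moment of the exponent vector (no hypothesis needed, since `5 = 0`);
* `soloInformed_orbit_moment_rotate` : under `∑ cⱼ = 0` the first moment is invariant under the
  cyclic relabelling `cⱼ ↦ cⱼ₊₁` (independence of the base point `𝔔` of the orbit);
* `soloInformed_orbit_telescope` : `aⱼ - aⱼ₋₁ = cⱼ` closes up cyclically exactly when `∑ cⱼ = 0`
  (the H90 bookkeeping `𝔄^{1-σ} = (ξ)` on the orbit).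
-/

namespace Summit.Langlands.Langlands.Theorems

/-- The orbit value `∑ⱼ (c₀+⋯+cⱼ)` equals minus the first moment `-(∑ j·cⱼ)` in `ZMod 5`. -/
theorem soloInformed_orbit_moment (c0 c1 c2 c3 c4 : ZMod 5) :
    c0 + (c0 + c1) + (c0 + c1 + c2) + (c0 + c1 + c2 + c3) + (c0 + c1 + c2 + c3 + c4)
      = -(c1 + 2 * c2 + 3 * c3 + 4 * c4) := by
  have h5 : (5 : ZMod 5) = 0 := by decide
  linear_combination (c0 + c1 + c2 + c3 + c4) * h5

/-- Base-point independence: if the exponents sum to zero, the first moment is invariant under the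
cyclic shift `(c₀,…,c₄) ↦ (c₁,…,c₄,c₀)`. -/
theorem soloInformed_orbit_moment_rotate (c0 c1 c2 c3 c4 : ZMod 5)
    (h : c0 + c1 + c2 + c3 + c4 = 0) :
    (c2 + 2 * c3 + 3 * c4 + 4 * c0) = (c1 + 2 * c2 + 3 * c3 + 4 * c4) := by
  have h5 : (5 : ZMod 5) = 0 := by decide
  linear_combination (-1 : ZMod 5) * h + c0 * h5

/-- H90 bookkeeping on one orbit: with `aⱼ = c₀ + ⋯ + cⱼ`, the cyclic differences `aⱼ - aⱼ₋₁`
(indices mod 5) reproduce `(c₀,…,c₄)` if and only if `∑ cⱼ = 0` (in any commutative ring). -/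
theorem soloInformed_orbit_telescope {R : Type*} [CommRing R] (c0 c1 c2 c3 c4 : R) :
    (c0 - (c0 + c1 + c2 + c3 + c4) = c0 ∧ (c0 + c1) - c0 = c1 ∧ (c0 + c1 + c2) - (c0 + c1) = c2 ∧
      (c0 + c1 + c2 + c3) - (c0 + c1 + c2) = c3 ∧
      (c0 + c1 + c2 + c3 + c4) - (c0 + c1 + c2 + c3) = c4)
      ↔ c0 + c1 + c2 + c3 + c4 = 0 := by
  constructor
  · rintro ⟨h0, -, -, -, -⟩
    linear_combination (-1 : R) * h0
  · intro h
    refine ⟨?_, ?_, ?_, ?_, ?_⟩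
    · linear_combination (-1 : R) * h
    · ring
    · ring
    · ring
    · ring

end Summit.Langlands.Langlands.Theorems
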